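import Summits.SmoothPoincare4.SmoothPoincare4.Theorems.SullivanDualWitnessChargeV15CapModelCharts
import Mathlib.Geometry.Manifold.MFDeriv.Tangent
import Mathlib.Geometry.Manifold.VectorBundle.Hom

/-!
# Cap model for crux `WitnessCharge`, III: the almost complex structure of the cap

Sequel to `…V15CapModelGlue.lean`, `…V15CapModelCharts.lean` (stub `stub_capModel` of skeleton
v15, line `Sketch`, lead c8). For `J` an almost complex structure on `Σ ∖ p` which is STANDARD on
the punctured `ε'`-chart-ball (`⟪Dψ (J v), c⟫ = ω₀(Dψ v, c)`, i.e. `DΦ ∘ J = i ∘ DΦ` for the flat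
chart `Φ`), the endomorphism field

  `capJ y = J a`      if `y = inl a`,
  `capJ y = flatI`    (multiplication by `i` on `ℝ⁴ = ℂ²`) on the added line `E`,

of the glued manifold `X` is an almost complex structure: `capJ² = −1`; it is multiplication by `i`
in the cap chart (`capJ_capInvMap : capJ (capInvMap q) ∘ d(capInvMap)_q = d(capInvMap)_q ∘ (i •)`,
from the standardness of `J` and the holomorphy of `(z, w) ↦ (z⁻¹, w)`); and it is smooth
(`capJX : AlmostComplexStructure (𝓡 4) ∞ X`): at points of `Σ ∖ p` its tangent-coordinate
expression is that of `J`, at points of `E` it is the constant `flatI` in the cap chart.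
-/

noncomputable section

set_option linter.dupNamespace false

open scoped Manifold ContDiff Topology
open Set Filter Function Literature.Geometry.Symplectic Literature.Topology.FourManifolds
  TopologicalSpace Bundle

namespace Summit.SmoothPoincare4.SmoothPoincare4.Theorems.WitnessCharge.PencilIncompleteness

variable {S : HomotopySphere 4} {p : S.carrier} {ε' : ℝ}
variable (hε' : 0 < ε')
  (hball : Metric.closedBall (extChartAt (𝓡 4) p p) ε' ⊆ (extChartAt (𝓡 4) p).target)
  (J : ∀ x : punctured p, TangentSpace (𝓡 4) x →L[ℝ] TangentSpace (𝓡 4) x)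

/-! ### `ℝ⁴ = ℂ²` bookkeeping -/

/-- `flatCx` inverts `realify`. -/
theorem flatCx_realify (q : ℂ × ℂ) : flatCx (realify q) = q := by
  rw [flatCx_apply]
  rfl

/-- `realify = flatCx.symm`. -/
theorem realify_eq_flatCx_symm (q : ℂ × ℂ) : realify q = flatCx.symm q := by
  rw [← flatCx_realify q, ContinuousLinearEquiv.symm_apply_apply, flatCx_realify]

/-- `flatI (flatCx.symm v) = flatCx.symm (i • v)`. -/
theorem flatI_flatCx_symm (v : ℂ × ℂ) : flatI (flatCx.symm v) = flatCx.symm (Complex.I • v) :=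
  flatCx.injective (by rw [flatCx_flatI, ContinuousLinearEquiv.apply_symm_apply,
    ContinuousLinearEquiv.apply_symm_apply])


/-- `i • (i • v) = −v` on `ℂ × ℂ`. Registered helper of the crux (stub `stub_capModel`, file III). -/
theorem helper_capModel_I_smul_I_smul : ∀ v : ℂ × ℂ, Complex.I • Complex.I • v = -v := by
  intro v
  rw [smul_smul, Complex.I_mul_I, neg_one_smul]

/-- `flatI² = −1`. -/
theorem flatI_flatI (v : EuclideanSpace ℝ (Fin 4)) : flatI (flatI v) = -v :=
  flatCx.injective (by rw [flatCx_flatI, flatCx_flatI, helper_capModel_I_smul_I_smul, map_neg])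

/-! ### The endomorphism field -/

/-- The almost complex structure of the cap as an endomorphism field: `J a` at `inl a`, `flatI`
on the added line. -/
def capJ (y : (capGlueData hε' hball).Glued) :
    EuclideanSpace ℝ (Fin 4) →L[ℝ] EuclideanSpace ℝ (Fin 4) := by
  classical
  exact if h : ∃ a, (capGlueData hε' hball).inl a = y then J (Classical.choose h) else flatI

/-- `capJ (inl a) = J a`. -/
theorem capJ_inl (a : punctured p) : capJ hε' hball J ((capGlueData hε' hball).inl a) = J a := by
  classical
  have h : ∃ a', (capGlueData hε' hball).inl a' = (capGlueData hε' hball).inl a := ⟨a, rfl⟩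
  have hc : Classical.choose h = a := (capGlueData hε' hball).inl_injective (Classical.choose_spec h)
  rw [capJ, dif_pos h]
  -- transport along `hc` (the fibre types agree definitionally)
  have key : ∀ b : punctured p, Classical.choose h = b → HEq (J (Classical.choose h)) (J b) := by
    rintro b rfl
    rfl
  exact eq_of_heq (key a hc)

/-- `capJ y = flatI` off `range inl`. -/
theorem capJ_of_not_mem {y : (capGlueData hε' hball).Glued}
    (hy : y ∉ range (capGlueData hε' hball).inl) : capJ hε' hball J y = flatI := by
  classical
  have h : ¬ ∃ a, (capGlueData hε' hball).inl a = y := fun ⟨a, ha⟩ => hy ⟨a, ha⟩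
  rw [capJ, dif_neg h]

variable (hJ2 : ∀ (x : punctured p) (v : TangentSpace (𝓡 4) x), J x (J x v) = -v)

include hJ2 in
/-- `capJ² = −1`. -/
theorem capJ_capJ (y : (capGlueData hε' hball).Glued) (v : EuclideanSpace ℝ (Fin 4)) :
    capJ hε' hball J y (capJ hε' hball J y v) = -v := by
  by_cases hy : y ∈ range (capGlueData hε' hball).inl
  · obtain ⟨a, rfl⟩ := hy
    rw [capJ_inl]
    exact hJ2 a v
  · rw [capJ_of_not_mem hε' hball J hy]
    exact flatI_flatI v

/-! ### Standardness of `J` in the flat chart: `DΦ ∘ J = i ∘ DΦ` -/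

variable (hJstd : ∀ x : punctured p, InPuncturedChartBall p ε' x →
    ∀ (v : TangentSpace (𝓡 4) x) (c : EuclideanSpace ℝ (Fin 4)),
      inner ℝ (fderiv ℝ inversion (extChartAt (𝓡 4) p x.1 - extChartAt (𝓡 4) p p)
        (mfderiv (𝓡 4) 𝓘(ℝ, EuclideanSpace ℝ (Fin 4))
          (fun z : punctured p => extChartAt (𝓡 4) p z.1) x (J x v))) c
      = stdSymplecticForm (fderiv ℝ inversion (extChartAt (𝓡 4) p x.1 - extChartAt (𝓡 4) p p)
        (mfderiv (𝓡 4) 𝓘(ℝ, EuclideanSpace ℝ (Fin 4))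
          (fun z : punctured p => extChartAt (𝓡 4) p z.1) x v)) c)

include hJstd in
/-- **`J` is multiplication by `i` in the flat chart**: `DΦ_x (J v) = i • DΦ_x v` on the
punctured `ε'`-chart-ball. -/
theorem mfderiv_flatChart_J {x : punctured p} (hx : x ∈ (flatChart hε' hball).source)
    (v : TangentSpace (𝓡 4) x) :
    mfderiv (𝓡 4) 𝓘(ℝ, ℂ × ℂ) (flatChart hε' hball) x (J x v) =
      mulByI (ℂ × ℂ) (mfderiv (𝓡 4) 𝓘(ℝ, ℂ × ℂ) (flatChart hε' hball) x v) := by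
  have hball' : InPuncturedChartBall p ε' x := by rwa [flatChart_source] at hx
  have h1 := realify_mfderiv_flatChart hε' hball hx (J x v)
  have h2 := realify_mfderiv_flatChart hε' hball hx v
  have hstd := eq_flatI_of_inner_eq_stdSymplecticForm (hJstd x hball' v)
  rw [← h1, ← h2] at hstd
  -- `realify (DΦ (J v)) = flatI (realify (DΦ v))`; apply `flatCx`
  have := congrArg flatCx hstd
  rwa [flatCx_realify, flatCx_flatI, flatCx_realify, ← mulByI_apply] at this

/-- The flat chart is differentiable in both directions. -/
theorem mdifferentiable_flatChart :
    (flatChart hε' hball).MDifferentiable (𝓡 4) 𝓘(ℝ, ℂ × ℂ) :=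
  ⟨(contMDiffOn_flatChart hε' hball).mdifferentiableOn (by simp),
    (contMDiffOn_flatChart_symm hε' hball).mdifferentiableOn (by simp)⟩

include hJstd in
/-- **`J ∘ DΦ⁻¹ = DΦ⁻¹ ∘ i`** at points of the flat region. -/
theorem J_mfderiv_flatChart_symm {q : ℂ × ℂ} (hq : q ∈ (flatChart hε' hball).target)
    (w : ℂ × ℂ) :
    J ((flatChart hε' hball).symm q) (mfderiv 𝓘(ℝ, ℂ × ℂ) (𝓡 4) (flatChart hε' hball).symm q w) =
      mfderiv 𝓘(ℝ, ℂ × ℂ) (𝓡 4) (flatChart hε' hball).symm q (mulByI (ℂ × ℂ) w) := by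
  set Φ := flatChart hε' hball
  have he := mdifferentiable_flatChart hε' hball
  have hx : Φ.symm q ∈ Φ.source := Φ.map_target hq
  have hsc := he.symm_comp_deriv hx   -- DΦ⁻¹ ∘ DΦ = id at `Φ.symm q`
  have hcs := he.comp_symm_deriv hq   -- DΦ ∘ DΦ⁻¹ = id at `q`
  rw [Φ.right_inv hq] at hsc
  have key := mfderiv_flatChart_J hε' hball J hJstd hx
    (mfderiv 𝓘(ℝ, ℂ × ℂ) (𝓡 4) Φ.symm q w)
  have hw : mfderiv (𝓡 4) 𝓘(ℝ, ℂ × ℂ) Φ (Φ.symm q)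
      (mfderiv 𝓘(ℝ, ℂ × ℂ) (𝓡 4) Φ.symm q w) = w :=
    congrArg (fun L : ℂ × ℂ →L[ℝ] ℂ × ℂ => L w) hcs
  rw [hw] at key
  -- apply `DΦ⁻¹` to `key`
  have := congrArg (mfderiv 𝓘(ℝ, ℂ × ℂ) (𝓡 4) Φ.symm q) key
  have hl : mfderiv 𝓘(ℝ, ℂ × ℂ) (𝓡 4) Φ.symm q
      (mfderiv (𝓡 4) 𝓘(ℝ, ℂ × ℂ) Φ (Φ.symm q)
        (J (Φ.symm q) (mfderiv 𝓘(ℝ, ℂ × ℂ) (𝓡 4) Φ.symm q w))) =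
      J (Φ.symm q) (mfderiv 𝓘(ℝ, ℂ × ℂ) (𝓡 4) Φ.symm q w) := by
    exact congrArg (fun L : EuclideanSpace ℝ (Fin 4) →L[ℝ] EuclideanSpace ℝ (Fin 4) =>
      L (J (Φ.symm q) (mfderiv 𝓘(ℝ, ℂ × ℂ) (𝓡 4) Φ.symm q w))) hsc
  rw [hl] at this
  exact this

/-! ### The differential of the cap chart, and `capJ = i` there -/

/-- For `0 < ‖t‖ < ρ`: `capInvMap (t, σ) = inl (Φ.symm (t⁻¹, σ))`. -/
theorem capInvMap_eq_inl {q : ℂ × ℂ} (hq : ‖q.1‖ < capRadius ε') (hq0 : q.1 ≠ 0) :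
    capInvMap hε' hball q =
      (capGlueData hε' hball).inl ((flatChart hε' hball).symm (q.1⁻¹, q.2)) := by
  have hb : (⟨q, hq⟩ : capDisc (capRadius ε')) ∈ (capGlue hε' hball).target :=
    (mem_capGlue_target_iff hε' hball _).2 hq0
  rw [capInvMap_of_lt hε' hball hq, ← (capGlueData hε' hball).inl_glue_symm hb, capGlueData_glue,
    capGlue_symm_apply]

/-- For `0 < ‖t‖ < ρ`, `(t⁻¹, σ)` lies in the target of the flat chart. -/
theorem invFst_mem_flatChart_target {q : ℂ × ℂ} (hq : ‖q.1‖ < capRadius ε') (hq0 : q.1 ≠ 0) :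
    (q.1⁻¹, q.2) ∈ (flatChart hε' hball).target := by
  have hb : (⟨q, hq⟩ : capDisc (capRadius ε')) ∈ (capGlue hε' hball).target :=
    (mem_capGlue_target_iff hε' hball _).2 hq0
  have := hb
  rw [capGlue, OpenPartialHomeomorph.trans_target, OpenPartialHomeomorph.trans_target] at this
  simpa using this.2.2

/-- `invFst` is complex differentiable off `t = 0`. -/
theorem differentiableAt_invFst {q : ℂ × ℂ} (hq0 : q.1 ≠ 0) : DifferentiableAt ℂ invFst q :=
  ((differentiableAt_fst (𝕜 := ℂ)).inv hq0).prodMk differentiableAt_snd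

/-- The real differential of `invFst` is complex linear: it commutes with `i`. -/
theorem fderiv_invFst_mulByI {q : ℂ × ℂ} (hq0 : q.1 ≠ 0) (v : ℂ × ℂ) :
    fderiv ℝ invFst q (mulByI (ℂ × ℂ) v) = mulByI (ℂ × ℂ) (fderiv ℝ invFst q v) := by
  have h := (differentiableAt_invFst hq0).fderiv_restrictScalars ℝ
  rw [h, mulByI_apply, mulByI_apply, ContinuousLinearMap.coe_restrictScalars', map_smul]

/-- **The differential of the cap chart off the added line**: for `0 < ‖t‖ < ρ`,
`d(capInvMap)_q = dΦ⁻¹_{(t⁻¹, σ)} ∘ D(invFst)_q`. -/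
theorem hasMFDerivAt_capInvMap_of_ne {q : ℂ × ℂ} (hq : ‖q.1‖ < capRadius ε') (hq0 : q.1 ≠ 0) :
    HasMFDerivAt 𝓘(ℝ, ℂ × ℂ) (𝓡 4) (capInvMap hε' hball) q
      ((mfderiv 𝓘(ℝ, ℂ × ℂ) (𝓡 4) (flatChart hε' hball).symm (q.1⁻¹, q.2)).comp
        (fderiv ℝ invFst q)) := by
  set d := capGlueData hε' hball
  set Φ := flatChart hε' hball
  -- the three differentials
  have hinv : HasMFDerivAt 𝓘(ℝ, ℂ × ℂ) 𝓘(ℝ, ℂ × ℂ) invFst q (fderiv ℝ invFst q) :=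
    hasMFDerivAt_iff_hasFDerivAt.2
      ((differentiableAt_invFst hq0).restrictScalars ℝ).hasFDerivAt
  have hsymm : HasMFDerivAt 𝓘(ℝ, ℂ × ℂ) (𝓡 4) Φ.symm (q.1⁻¹, q.2)
      (mfderiv 𝓘(ℝ, ℂ × ℂ) (𝓡 4) Φ.symm (q.1⁻¹, q.2)) :=
    ((mdifferentiable_flatChart hε' hball).mdifferentiableAt_symm
      (invFst_mem_flatChart_target hε' hball hq hq0)).hasMFDerivAt
  have hinl := hasMFDerivAt_inl hε' hball (Φ.symm (q.1⁻¹, q.2))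
  have hcomp : HasMFDerivAt 𝓘(ℝ, ℂ × ℂ) (𝓡 4) (d.inl ∘ Φ.symm ∘ invFst) q
      ((ContinuousLinearMap.id ℝ (EuclideanSpace ℝ (Fin 4))).comp
        ((mfderiv 𝓘(ℝ, ℂ × ℂ) (𝓡 4) Φ.symm (q.1⁻¹, q.2)).comp (fderiv ℝ invFst q))) := by
    have h1 : HasMFDerivAt 𝓘(ℝ, ℂ × ℂ) (𝓡 4) (Φ.symm ∘ invFst) q
        ((mfderiv 𝓘(ℝ, ℂ × ℂ) (𝓡 4) Φ.symm (q.1⁻¹, q.2)).comp (fderiv ℝ invFst q)) :=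
      HasMFDerivAt.comp q (by simpa [invFst_apply] using hsymm) hinv
    exact HasMFDerivAt.comp q (by simpa [comp_apply, invFst_apply] using hinl) h1
  rw [ContinuousLinearMap.id_comp] at hcomp
  refine hcomp.congr_of_eventuallyEq ?_
  -- `capInvMap = inl ∘ Φ.symm ∘ invFst` near `q`
  have hopen : IsOpen ({q' : ℂ × ℂ | ‖q'.1‖ < capRadius ε'} ∩ {q' | q'.1 ≠ 0}) :=
    (capDisc (capRadius ε')).2.inter (isOpen_ne_fun continuous_fst continuous_const)
  filter_upwards [hopen.mem_nhds ⟨hq, hq0⟩] with q' hq'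
  rw [capInvMap_eq_inl hε' hball hq'.1 hq'.2]
  rfl

/-- `mfderiv` form of `hasMFDerivAt_capInvMap_of_ne`. -/
theorem mfderiv_capInvMap_of_ne {q : ℂ × ℂ} (hq : ‖q.1‖ < capRadius ε') (hq0 : q.1 ≠ 0) :
    mfderiv 𝓘(ℝ, ℂ × ℂ) (𝓡 4) (capInvMap hε' hball) q =
      (mfderiv 𝓘(ℝ, ℂ × ℂ) (𝓡 4) (flatChart hε' hball).symm (q.1⁻¹, q.2)).comp
        (fderiv ℝ invFst q) :=
  (hasMFDerivAt_capInvMap_of_ne hε' hball hq hq0).mfderiv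

/-- The preferred chart of the cap disc (an open subset of `ℂ × ℂ`) is the inclusion. -/
theorem chartAt_capDisc_apply (b₀ b : capDisc (capRadius ε')) :
    chartAt (ℂ × ℂ) b₀ b = (b : ℂ × ℂ) :=
  helper_capModel_chartAt_opens_apply _ b₀ b

/-- **The extended chart of `X` at a point of the added line**, on `range inr`:
`extChartAt (inr b₀) (inr b) = flatCx.symm b`. -/
theorem extChartAt_inr_apply {b₀ : capDisc (capRadius ε')}
    (hb₀ : (capGlueData hε' hball).inr b₀ ∉ range (capGlueData hε' hball).inl)
    (b : capDisc (capRadius ε')) :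
    extChartAt (𝓡 4) ((capGlueData hε' hball).inr b₀) ((capGlueData hε' hball).inr b) =
      flatCx.symm (b : ℂ × ℂ) := by
  simp only [extChartAt, OpenPartialHomeomorph.extend_coe, comp_apply, modelWithCornersSelf_coe,
    id_eq, chartAt_inr_of_not_mem hε' hball hb₀, SmoothGlueData.chartB_apply_inr, capGlueData_linB,
    chartAt_capDisc_apply]

/-- The source of that extended chart is all of `range inr`. -/
theorem extChartAt_inr_source {b₀ : capDisc (capRadius ε')}
    (hb₀ : (capGlueData hε' hball).inr b₀ ∉ range (capGlueData hε' hball).inl) :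
    (extChartAt (𝓡 4) ((capGlueData hε' hball).inr b₀)).source =
      range (capGlueData hε' hball).inr := by
  rw [extChartAt_source, chartAt_inr_of_not_mem hε' hball hb₀, SmoothGlueData.chartB_source]
  have : (chartAt (ℂ × ℂ) b₀).source = univ := by
    show ((chartAt (ℂ × ℂ) (b₀ : ℂ × ℂ)).subtypeRestr ⟨b₀⟩).source = univ
    rw [OpenPartialHomeomorph.subtypeRestr_source, chartAt_self_eq,
      OpenPartialHomeomorph.refl_source, preimage_univ]
  rw [this, image_univ]

/-- **The differential of the cap chart on the added line**: for `t = 0`,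
`d(capInvMap)_q = flatCx.symm` (the preferred chart there is the cap chart itself). -/
theorem hasMFDerivAt_capInvMap_of_eq {q : ℂ × ℂ} (hq : ‖q.1‖ < capRadius ε') (hq0 : q.1 = 0) :
    HasMFDerivAt 𝓘(ℝ, ℂ × ℂ) (𝓡 4) (capInvMap hε' hball) q
      (flatCx.symm : ℂ × ℂ →L[ℝ] EuclideanSpace ℝ (Fin 4)) := by
  set d := capGlueData hε' hball
  have hnot : d.inr ⟨q, hq⟩ ∉ range d.inl := by
    rw [inr_mem_range_inl_iff]
    simpa using hq0
  refine ⟨(contMDiffAt_capInvMap hε' hball hq).continuousAt, ?_⟩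
  have hev : writtenInExtChartAt 𝓘(ℝ, ℂ × ℂ) (𝓡 4) q (capInvMap hε' hball) =ᶠ[𝓝[range 𝓘(ℝ, ℂ × ℂ)]
      (extChartAt 𝓘(ℝ, ℂ × ℂ) q q)] (flatCx.symm : ℂ × ℂ → EuclideanSpace ℝ (Fin 4)) := by
    refine mem_nhdsWithin_of_mem_nhds ?_
    have : {q' : ℂ × ℂ | ‖q'.1‖ < capRadius ε'} ∈ 𝓝 (extChartAt 𝓘(ℝ, ℂ × ℂ) q q) := by
      rw [extChartAt_model_space_eq_id, PartialEquiv.refl_coe, id_eq]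
      exact (capDisc (capRadius ε')).2.mem_nhds hq
    filter_upwards [this] with q' hq'
    simp only [writtenInExtChartAt, comp_apply, extChartAt_model_space_eq_id, PartialEquiv.refl_coe,
      PartialEquiv.refl_symm, id_eq]
    rw [capInvMap_of_lt hε' hball hq, capInvMap_of_lt hε' hball hq', extChartAt_inr_apply hε' hball hnot]
  refine (flatCx.symm : ℂ × ℂ →L[ℝ] EuclideanSpace ℝ (Fin 4)).hasFDerivAt.hasFDerivWithinAt
    |>.congr_of_eventuallyEq hev ?_
  simp only [writtenInExtChartAt, comp_apply, extChartAt_model_space_eq_id, PartialEquiv.refl_coe,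
    PartialEquiv.refl_symm, id_eq]
  rw [capInvMap_of_lt hε' hball hq, extChartAt_inr_apply hε' hball hnot]
  rfl

include hJstd in
/-- **`capJ` is multiplication by `i` in the cap chart**:
`capJ (capInvMap q) (d(capInvMap)_q v) = d(capInvMap)_q (i • v)` for `‖q.1‖ < ρ`. -/
theorem capJ_capInvMap {q : ℂ × ℂ} (hq : ‖q.1‖ < capRadius ε') (v : ℂ × ℂ) :
    capJ hε' hball J (capInvMap hε' hball q) (mfderiv 𝓘(ℝ, ℂ × ℂ) (𝓡 4) (capInvMap hε' hball) q v) =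
      mfderiv 𝓘(ℝ, ℂ × ℂ) (𝓡 4) (capInvMap hε' hball) q (Complex.I • v) := by
  set d := capGlueData hε' hball
  by_cases hq0 : q.1 = 0
  · -- on the added line: everything is `flatCx.symm`, `flatI`
    have hnot : capInvMap hε' hball q ∉ range d.inl := by
      rw [capInvMap_of_lt hε' hball hq, inr_mem_range_inl_iff]
      simpa using hq0
    rw [capJ_of_not_mem hε' hball J hnot, (hasMFDerivAt_capInvMap_of_eq hε' hball hq hq0).mfderiv]
    exact flatI_flatCx_symm v
  · rw [mfderiv_capInvMap_of_ne hε' hball hq hq0, capInvMap_eq_inl hε' hball hq hq0, capJ_inl]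
    show J ((flatChart hε' hball).symm (q.1⁻¹, q.2))
        (mfderiv 𝓘(ℝ, ℂ × ℂ) (𝓡 4) (flatChart hε' hball).symm (q.1⁻¹, q.2)
          (fderiv ℝ invFst q v)) =
      mfderiv 𝓘(ℝ, ℂ × ℂ) (𝓡 4) (flatChart hε' hball).symm (q.1⁻¹, q.2)
        (fderiv ℝ invFst q (Complex.I • v))
    rw [J_mfderiv_flatChart_symm hε' hball J hJstd (invFst_mem_flatChart_target hε' hball hq hq0),
      ← mulByI_apply, fderiv_invFst_mulByI hq0]

end Summit.SmoothPoincare4.SmoothPoincare4.Theorems.WitnessCharge.PencilIncompleteness
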